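import Summits.CriticalPhenomena.PercolationContinuityZ3.Theorems.Transplant.FKConnectivityAllQAntipodalPolar
import HarnessLib

/-!
# Connectivity correlation inequalities for `φ_{w,q}`, every `q > 0` — `δ ≥ 0` is SUPPORT-LOCAL: reduction to the minors of the support, degenerate triples

Proof file (`--supports stmt-CriticalPhenomena-4575`), census lineage (gen 37) of LANE 2's FK sub-programme; builds on p205010
(kernel theorem, internal audit signed; external expert review pending).  No definitions, no named facts, no sorries.

Generic (support-level) half of census g37's measure-level statement (the series–parallel half is `…Pat3DeltaSP.lean`).  In census
gen 25's polar expansion `2δ_w(z;s,t) = Σ_{F,ρ} c_w(F,ρ)·T_q(z,s,t;F,ρ)` (`FK.two_mul_deltaMass_eq_sum_antipodal`) the coefficient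
`c_w(F,ρ) = ∏_{e∈F} w_e(1−w_e) ∏_{e∈ρ} w_e² ∏_{e∉F∪ρ}(1−w_e)²` VANISHES unless `F ∪ ρ ⊆ supp(w)` (`FK.antipodalCoef_eq_zero_of_weight_zero`);
hence `δ_w(z;s,t) ≥ 0` as soon as Conjecture T's functional is nonnegative on the minors `(F, C)`, `F, C ⊆ N`, of any edge set
`N ⊇ supp(w)` (`FK.deltaMass_nonneg_of_support`) — the global hypothesis `AntipodalTOn V q` of `FK.deltaMass_nonneg_of_antipodalTOn`
localised to the support.  From `δ ≥ 0` pointwise in the marks: the hub inequality ALR (13)/(14) (`FK.hubUnder_of_deltaMass_nonneg`)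
and the sharper correlation of `{s ↔ t}` with `{z ↔ s} ∪ {z ↔ t}` (`FK.real_conn_union_le_of_deltaMass_nonneg`).  Degenerate triples:
a vertex on no pair of the support is joined to nothing (`FK.rcWeightW_eq_zero_of_reachable_isolated`,
`FK.rcReal_openConn_eq_zero_of_isolated`), so `δ ≥ 0` at the pairwise distinct triples ON the support already gives the hub
inequality / the sharper correlation at EVERY triple of vertices (`FK.hubUnder_of_deltaMass_nonneg_on`,
`FK.real_conn_union_le_of_deltaMass_nonneg_on`).
[cite: AyyerLinussonRavichandran2025, §7 eq. (13)–(15), Conj. 7.1 (p. 22)] [cite: Grimmett2006, §1.4 eq. (1.20) (p. 15); §3.9 (p. 63)]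
-/

namespace Summit.CriticalPhenomena.PercolationContinuityZ3.Theorems

namespace FK

open MeasureTheory Set Literature.Probability.LatticeModels Literature.Probability.Percolation
open Literature.Probability.Percolation.BHK2006 (weight)
open Literature.Probability.Percolation.DecisionTree (ind ind_of_mem ind_of_not_mem ind_nonneg)
open scoped Classical

variable {V : Type*} [Fintype V] (w : Sym2 V → unitInterval)

/-! ### `c_w(F,ρ)` lives on the support; the support-local reduction -/

/-- `c_w(F,ρ) = 0` as soon as an edge of `F ∪ ρ` has weight `0`. [folklore] -/
theorem antipodalCoef_eq_zero_of_weight_zero {F ρ : BondConfig V} {e : Sym2 V} (he : e ∈ F ∨ e ∈ ρ)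
    (hw : ((w e : unitInterval) : ℝ) = 0) : antipodalCoef w F ρ = 0 := by
  unfold antipodalCoef
  apply Finset.prod_eq_zero (Finset.mem_univ e)
  by_cases hF : e ∈ F
  · rw [if_pos hF, hw, zero_mul]
  · rw [if_neg hF, if_pos (he.resolve_left hF), hw]
    norm_num

/-- **Support-local reduction**: if `w` is supported in `N` and `T_q(z,s,t;F,C) ≥ 0` for all disjoint `F, C ⊆ N`, then
`δ_w(z; s, t) ≥ 0`. [cite: AyyerLinussonRavichandran2025, §7 (p. 22)] -/
theorem deltaMass_nonneg_of_support {q : ℝ} {N : Finset (Sym2 V)} {z s t : V}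
    (hw : ∀ e, ((w e : unitInterval) : ℝ) ≠ 0 → e ∈ (↑N : Set (Sym2 V)))
    (h : ∀ F C : Finset (Sym2 V), F ⊆ N → C ⊆ N → Disjoint F C →
      0 ≤ antipodalT q z s t (↑F : BondConfig V) (↑C : BondConfig V)) :
    0 ≤ deltaMass w q z s t := by
  have h2 : 0 ≤ 2 * deltaMass w q z s t := by
    rw [two_mul_deltaMass_eq_sum_antipodal]
    refine Finset.sum_nonneg fun F _ => Finset.sum_nonneg fun ρ _ => ?_
    by_cases hd : Disjoint F ρ
    · rw [if_pos hd]
      by_cases hex : ∃ e, (e ∈ F ∨ e ∈ ρ) ∧ e ∉ N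
      · obtain ⟨e, he, heN⟩ := hex
        have hwe : ((w e : unitInterval) : ℝ) = 0 := by
          by_contra hne
          exact heN (hw e hne)
        rw [antipodalCoef_eq_zero_of_weight_zero w he hwe, zero_mul]
      · have hsub : ∀ e, e ∈ F ∨ e ∈ ρ → e ∈ N := fun e he => by
          by_contra heN
          exact hex ⟨e, he, heN⟩
        set F' : Finset (Sym2 V) := Finset.univ.filter (fun e => e ∈ F) with hF'
        set ρ' : Finset (Sym2 V) := Finset.univ.filter (fun e => e ∈ ρ) with hρ'
        have cF : (↑F' : BondConfig V) = F := by ext e; simp [hF']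
        have cρ : (↑ρ' : BondConfig V) = ρ := by ext e; simp [hρ']
        have hFN : F' ⊆ N := fun e he => hsub e (Or.inl (by simpa [hF'] using he))
        have hρN : ρ' ⊆ N := fun e he => hsub e (Or.inr (by simpa [hρ'] using he))
        have hd' : Disjoint F' ρ' := by
          rw [← Finset.disjoint_coe, cF, cρ]
          exact hd
        have key := h F' ρ' hFN hρN hd'
        rw [cF, cρ] at key
        exact mul_nonneg (antipodalCoef_nonneg w F ρ) key
    · rw [if_neg hd]
  linarith

/-! ### From `δ ≥ 0` to the measure statements -/

/-- **The hub inequality from `δ ≥ 0`** (pointwise in the marks): `δ_w(z; s, t) ≥ 0` gives ALR (14)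
`φ(z ↔ s)·φ(t ↔ s) ≤ φ(z ↔ s ↔ t)` for `φ_{w,q}`. [cite: AyyerLinussonRavichandran2025, §7 eq. (13)–(14) (p. 22)] -/
theorem hubUnder_of_deltaMass_nonneg {q : ℝ} (hq : 0 < q) {z s t : V} (hδ : 0 ≤ deltaMass w q z s t) :
    HubUnder (rcMeasureW w q ∅) z s t := by
  obtain ⟨m1, m2, m3, -, -, -, mZ⟩ := patMass_patterns w q z s t
  have h0 := patMass_nonneg w hq.le (patSep z s t)
  have h1 := patMass_nonneg w hq.le (patST z s t)
  have h2 := patMass_nonneg w hq.le (patZS z s t)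
  have h3 := patMass_nonneg w hq.le (patZT z s t)
  have h4 := patMass_nonneg w hq.le (patAll z s t)
  unfold deltaMass at hδ
  refine real_mul_le_of_mass w hq (openConn z s) (openConn t s) ?_
  change patMass w q (openConn z s) * patMass w q (openConn t s) ≤
    rcPartitionFunctionW w q ∅ * patMass w q (openConn z s ∩ openConn t s)
  rw [m1, m2, m3, mZ]
  nlinarith [mul_nonneg h1 h3, mul_nonneg h3 h4]

/-- **The sharp consequence of `δ ≥ 0`** (pointwise in the marks): the positive correlation of `{s ↔ t}` and
`{z ↔ s} ∪ {z ↔ t}` under `φ_{w,q}`. [cite: AyyerLinussonRavichandran2025, §7 (p. 22)] -/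
theorem real_conn_union_le_of_deltaMass_nonneg {q : ℝ} (hq : 0 < q) {z s t : V} (hδ : 0 ≤ deltaMass w q z s t) :
    (rcMeasureW w q ∅).real (openConn s t) * (rcMeasureW w q ∅).real (openConn z s ∪ openConn z t) ≤
      (rcMeasureW w q ∅).real univ * (rcMeasureW w q ∅).real (openConn s t ∩ (openConn z s ∪ openConn z t)) := by
  obtain ⟨-, -, -, m4, m5, m6, mZ⟩ := patMass_patterns w q z s t
  unfold deltaMass at hδ
  refine real_mul_le_of_mass w hq (openConn s t) (openConn z s ∪ openConn z t) ?_
  change patMass w q (openConn s t) * patMass w q (openConn z s ∪ openConn z t) ≤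
    rcPartitionFunctionW w q ∅ * patMass w q (openConn s t ∩ (openConn z s ∪ openConn z t))
  rw [m4, m5, m6, mZ]
  nlinarith

/-! ### Degenerate triples -/

/-- A configuration of positive weight under a weight vector supported in `N` cannot connect a vertex `v` lying on no pair of `N`
to a different vertex. [cite: Grimmett2006, §1.4 eq. (1.20) (p. 15)] -/
theorem rcWeightW_eq_zero_of_reachable_isolated {q : ℝ} {N : Finset (Sym2 V)} {v a : V}
    (hw : ∀ e, ((w e : unitInterval) : ℝ) ≠ 0 → e ∈ (↑N : Set (Sym2 V))) (hv : ¬ ∃ e ∈ N, v ∈ e) (hva : v ≠ a)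
    {ω : BondConfig V} (hω : (openGraph ω).Reachable v a) : rcWeightW w q ∅ ω = 0 := by
  obtain ⟨p⟩ := hω
  cases p with
  | nil => exact absurd rfl hva
  | @cons _ u _ hadj _ =>
    have he : s(v, u) ∈ ω := ((openGraph_adj ω v u).1 hadj).1
    have hw0 : ((w s(v, u) : unitInterval) : ℝ) = 0 := by
      by_contra hne
      exact hv ⟨s(v, u), hw _ hne, Sym2.mem_mk_left v u⟩
    have hW : weight (fun e => ((w e : unitInterval) : ℝ)) ω = 0 := by
      unfold weight
      exact Finset.prod_eq_zero (Finset.mem_univ (s(v, u))) (by simp only [if_pos he]; exact hw0)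
    unfold rcWeightW
    rw [hW, zero_mul]

/-- `φ_{w,q}(v ↔ a) = 0` for a vertex `v` on no pair of the support and `a ≠ v`. [cite: Grimmett2006, §1.4 eq. (1.20) (p. 15)] -/
theorem rcReal_openConn_eq_zero_of_isolated {q : ℝ} (hq : 0 < q) {N : Finset (Sym2 V)} {v a : V}
    (hw : ∀ e, ((w e : unitInterval) : ℝ) ≠ 0 → e ∈ (↑N : Set (Sym2 V))) (hv : ¬ ∃ e ∈ N, v ∈ e) (hva : v ≠ a) :
    (rcMeasureW w q ∅).real (openConn v a) = 0 ∧ (rcMeasureW w q ∅).real (openConn a v) = 0 := by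
  have key : ∀ A : Set (BondConfig V), (∀ ω ∈ A, (openGraph ω).Reachable v a) → (rcMeasureW w q ∅).real A = 0 := by
    intro A hA
    rw [rcMeasureW_real_eq_sum_div w hq ∅ A]
    have h0 : ∑ ω : BondConfig V, rcWeightW w q ∅ ω * ind A ω = 0 := by
      refine Finset.sum_eq_zero fun ω _ => ?_
      by_cases hωA : ω ∈ A
      · rw [rcWeightW_eq_zero_of_reachable_isolated w hw hv hva (hA ω hωA), zero_mul]
      · rw [ind_of_not_mem hωA, mul_zero]
    rw [h0, zero_div]
  exact ⟨key _ fun ω hω => (mem_openConn_iff' v a ω).1 hω, key _ fun ω hω => ((mem_openConn_iff' a v ω).1 hω).symm⟩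

/-- **From `δ ≥ 0` at the distinct triples on the support to the hub inequality at EVERY triple of vertices.**  If `w` is
supported in `N` and `δ_w(b;s,t) ≥ 0` for all pairwise distinct `b, s, t` lying on pairs of `N`, then
`φ_{w,q}(o ↔ a)·φ_{w,q}(b ↔ a) ≤ φ_{w,q}(o ↔ a ↔ b)` for all `o, a, b : V` (coincident marks are identities / `μ(A)² ≤ μ(Ω)μ(A)`;
marks off the support are isolated). [cite: AyyerLinussonRavichandran2025, §7 eq. (13)–(14) (p. 22)] -/
theorem hubUnder_of_deltaMass_nonneg_on {q : ℝ} (hq : 0 < q) {N : Finset (Sym2 V)}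
    (hw : ∀ e, ((w e : unitInterval) : ℝ) ≠ 0 → e ∈ (↑N : Set (Sym2 V)))
    (hδ : ∀ b s t : V, (∃ e ∈ N, b ∈ e) → (∃ e ∈ N, s ∈ e) → (∃ e ∈ N, t ∈ e) → b ≠ s → b ≠ t → s ≠ t →
      0 ≤ deltaMass w q b s t) (o a b : V) :
    HubUnder (rcMeasureW w q ∅) o a b := by
  haveI := isProbabilityMeasure_rcMeasureW w hq (∅ : Set V)
  have huniv : ∀ c : V, (openConn c c : Set (BondConfig V)) = Set.univ := fun c =>
    Set.eq_univ_of_forall fun ω => (mem_openConn_iff' c c ω).2 SimpleGraph.Reachable.rfl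
  unfold HubUnder
  by_cases hoa : o = a
  · subst hoa
    rw [huniv, Set.univ_inter]
  by_cases hba : b = a
  · subst hba
    rw [huniv, Set.inter_univ, mul_comm]
  by_cases hob : o = b
  · subst hob
    rw [Set.inter_self]
    exact mul_le_mul_of_nonneg_right (measureReal_mono (Set.subset_univ _)) measureReal_nonneg
  have hnn : 0 ≤ (rcMeasureW w q ∅).real univ * (rcMeasureW w q ∅).real (openConn o a ∩ openConn b a) :=
    mul_nonneg measureReal_nonneg measureReal_nonneg
  by_cases ho : ∃ e ∈ N, o ∈ e
  swap
  · rw [(rcReal_openConn_eq_zero_of_isolated w hq hw ho hoa).1, zero_mul]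
    exact hnn
  by_cases hb : ∃ e ∈ N, b ∈ e
  swap
  · rw [(rcReal_openConn_eq_zero_of_isolated w hq hw hb hba).1, mul_zero]
    exact hnn
  by_cases ha : ∃ e ∈ N, a ∈ e
  swap
  · rw [(rcReal_openConn_eq_zero_of_isolated w hq hw ha (Ne.symm hoa)).2, zero_mul]
    exact hnn
  exact hubUnder_of_deltaMass_nonneg w hq (hδ o a b ho ha hb hoa hob (Ne.symm hba))

/-- **From `δ ≥ 0` at the distinct triples on the support to the sharper correlation at EVERY triple**:
`φ(s ↔ t)·φ(b ↔ {s,t}) ≤ φ(Ω)·φ(s ↔ t, b ↔ {s,t})` for all `b, s, t : V`. [cite: AyyerLinussonRavichandran2025, §7 (p. 22)] -/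
theorem real_conn_union_le_of_deltaMass_nonneg_on {q : ℝ} (hq : 0 < q) {N : Finset (Sym2 V)}
    (hw : ∀ e, ((w e : unitInterval) : ℝ) ≠ 0 → e ∈ (↑N : Set (Sym2 V)))
    (hδ : ∀ b s t : V, (∃ e ∈ N, b ∈ e) → (∃ e ∈ N, s ∈ e) → (∃ e ∈ N, t ∈ e) → b ≠ s → b ≠ t → s ≠ t →
      0 ≤ deltaMass w q b s t) (b s t : V) :
    (rcMeasureW w q ∅).real (openConn s t) * (rcMeasureW w q ∅).real (openConn b s ∪ openConn b t) ≤
      (rcMeasureW w q ∅).real univ * (rcMeasureW w q ∅).real (openConn s t ∩ (openConn b s ∪ openConn b t)) := by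
  haveI := isProbabilityMeasure_rcMeasureW w hq (∅ : Set V)
  have huniv : ∀ c : V, (openConn c c : Set (BondConfig V)) = Set.univ := fun c =>
    Set.eq_univ_of_forall fun ω => (mem_openConn_iff' c c ω).2 SimpleGraph.Reachable.rfl
  by_cases hst : s = t
  · subst hst
    rw [huniv, Set.univ_inter, Set.union_self]
  by_cases hbs : b = s
  · subst hbs
    rw [huniv, Set.univ_union, Set.inter_univ, mul_comm]
  by_cases hbt : b = t
  · subst hbt
    rw [huniv, Set.union_univ, Set.inter_univ, mul_comm]
  have hnn : 0 ≤ (rcMeasureW w q ∅).real univ *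
      (rcMeasureW w q ∅).real (openConn s t ∩ (openConn b s ∪ openConn b t)) :=
    mul_nonneg measureReal_nonneg measureReal_nonneg
  by_cases hs : ∃ e ∈ N, s ∈ e
  swap
  · rw [(rcReal_openConn_eq_zero_of_isolated w hq hw hs hst).1, zero_mul]
    exact hnn
  by_cases ht : ∃ e ∈ N, t ∈ e
  swap
  · rw [(rcReal_openConn_eq_zero_of_isolated w hq hw ht (Ne.symm hst)).2, zero_mul]
    exact hnn
  by_cases hb : ∃ e ∈ N, b ∈ e
  swap
  · have h1 := (rcReal_openConn_eq_zero_of_isolated w hq hw hb hbs).1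
    have h2 := (rcReal_openConn_eq_zero_of_isolated w hq hw hb hbt).1
    have hU : (rcMeasureW w q ∅).real (openConn b s ∪ openConn b t) = 0 :=
      le_antisymm ((measureReal_union_le _ _).trans (by rw [h1, h2, add_zero])) measureReal_nonneg
    rw [hU, mul_zero]
    exact hnn
  exact real_conn_union_le_of_deltaMass_nonneg w hq (hδ b s t hb hs ht hbs hbt hst)

end FK

end Summit.CriticalPhenomena.PercolationContinuityZ3.Theorems
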